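import Literature.Analysis.FluidPDE.PassiveScalarSteadyTest
import Literature.Analysis.FluidPDE.PassiveScalarExistenceApprox
import Literature.Analysis.FluidPDE.TorusWeakNSGluing
import Literature.Analysis.FunctionSpaces.LpNormByDuality
import Literature.Analysis.FunctionSpaces.SpaceTimeWeakCompactness
import Summits.AnomalousDissipation.AnomalousDissipation.Theorems.TwoAndHalfDScalarLift2halfDRScalarDescent

/-!
# The weak `L²` trace of a weak sourced passive scalar at almost every time

Summit-side helper file (everything proved) for the `2½`-dimensional scalar lift
(`Summit.AnomalousDissipation.AnomalousDissipation.Theses.TwoAndHalfD.ScalarLift2halfDR`): for a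
weak sourced scalar `θ` on `T^d × [0, T)` (`Torus.IsWeakScalarTransportForcedOn`), for almost
every `σ ∈ (0, T)` the slice `θ σ` is in `L²` and satisfies the time-sliced weak identity

  `∫ θ(σ) ψ(σ) = ∫ θ₀ ψ(0) + ∫_{(0,σ]} ( ∫ θ (∂ₜψ + u·∇ψ + κΔψ) + ∫ s ψ )`

simultaneously for EVERY smooth space–time `ψ` (file `…Trace`), the boundary term needed to glue
weak scalar solutions at the time `σ`. This first half treats STEADY tests: the identity
`∫ θ(σ) φ = ∫ θ₀ φ + ∫_{(0,σ]} (∫ θ (u·∇φ + κΔφ) + ∫ s φ)` holds a.e. in time for each fixed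
smooth `φ` (DiPerna–Lions 1989, (13)–(14); tree: `IsWeakScalarTransportForcedOn.ae_integral_mul_eq`),
hence — by second countability of `L²(T^d)`, smooth approximation, and `L²`-continuity of both
sides at a time of bounded `L²` norm — for all smooth `φ` at once at a.e. time
(`ae_forall_sliceIdentity`).
-/

noncomputable section

open MeasureTheory Set Filter Topology Function UnitAddTorus Metric
open scoped ENNReal NNReal InnerProductSpace ContDiff
open Literature.Analysis.FunctionSpaces Literature.Analysis.FunctionSpaces.Torus
open Literature.Analysis.FluidPDE Literature.Analysis.FluidPDE.Torus

namespace Summit.AnomalousDissipation.AnomalousDissipation.Theorems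

set_option linter.dupNamespace false

section Trace

variable {d : Type*} [Fintype d]
variable {T κ : ℝ} {u : ℝ → UnitAddTorus d → EuclideanSpace ℝ d} {s : ℝ → UnitAddTorus d → ℝ}
  {θ₀ : UnitAddTorus d → ℝ} {θ : ℝ → UnitAddTorus d → ℝ}

/-- **A full-measure subset of an open interval is dense in it**: if `P` holds a.e. on `(a, b)`
and `σ ∈ (a, b)`, then `σ` is in the closure of `{t ∈ (a, b) | P t}`. [folklore] -/
theorem mem_closure_of_ae_Ioo {a b : ℝ} {P : ℝ → Prop} (hP : ∀ᵐ t ∂(volume.restrict (Ioo a b)), P t)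
    {σ : ℝ} (hσ : σ ∈ Ioo a b) : σ ∈ closure {t | t ∈ Ioo a b ∧ P t} := by
  rw [Metric.mem_closure_iff]
  intro ε hε
  by_contra hne
  push Not at hne
  -- the interval `(σ, min b (σ + ε))` is contained in the complement
  set b' : ℝ := min b (σ + ε) with hb'
  have hσb' : σ < b' := lt_min hσ.2 (by linarith)
  have hsub : Ioo σ b' ⊆ {t | t ∈ Ioo a b ∧ ¬P t} := by
    intro t ht
    have htab : t ∈ Ioo a b := ⟨hσ.1.trans ht.1, ht.2.trans_le (min_le_left _ _)⟩
    refine ⟨htab, fun hPt => ?_⟩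
    have hdist : dist σ t < ε := by
      rw [Real.dist_eq, abs_sub_comm, abs_of_pos (by linarith [ht.1])]
      linarith [ht.2, min_le_right b (σ + ε)]
    exact (lt_irrefl _) ((hne t ⟨htab, hPt⟩).trans_lt hdist)
  have hnull : volume {t | t ∈ Ioo a b ∧ ¬P t} = 0 := by
    rw [ae_restrict_iff' measurableSet_Ioo, ae_iff] at hP
    convert hP using 2
    ext t
    simp only [mem_setOf_eq, Classical.not_imp]
  have hpos : 0 < volume (Ioo σ b') := by
    rw [Real.volume_Ioo]
    exact ENNReal.ofReal_pos.2 (by linarith)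
  exact (lt_irrefl (0 : ℝ≥0∞)) (hpos.trans_le ((measure_mono hsub).trans hnull.le))

/-- Hölder at a slice: `|∫ f g| ≤ √C ‖g‖₂` when `∫⁻ ‖f‖ₑ² ≤ C`. [folklore] -/
theorem abs_integral_mul_le_sqrt_mul_eLpNorm {f g : UnitAddTorus d → ℝ} (hf : AEStronglyMeasurable f volume)
    (hg : MemLp g 2 volume) {C : ℝ≥0} (hC : ∫⁻ x, ‖f x‖ₑ ^ 2 ≤ C) :
    |∫ x, f x * g x| ≤ Real.sqrt C * (eLpNorm g 2 volume).toReal := by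
  have hf2 : eLpNorm f 2 volume ≤ (C : ℝ≥0∞) ^ (1 / 2 : ℝ) := by
    rw [Literature.Analysis.FunctionSpaces.eLpNorm_two_eq_pow_two_rpow_half,
      Literature.Analysis.FunctionSpaces.eLpNorm_two_pow_two_eq_lintegral]
    exact ENNReal.rpow_le_rpow hC (by norm_num)
  have h1 := Literature.Analysis.FunctionSpaces.enorm_integral_mul_le_eLpNorm_mul_eLpNorm (p := 2) (q := 2) (μ := volume) hf hg.1
  have hfin : (C : ℝ≥0∞) ^ (1 / 2 : ℝ) * eLpNorm g 2 volume ≠ ⊤ :=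
    ENNReal.mul_ne_top (ENNReal.rpow_ne_top_of_nonneg (by norm_num) ENNReal.coe_ne_top) hg.eLpNorm_ne_top
  have h2 : ‖∫ x, f x * g x‖ₑ ≤ (C : ℝ≥0∞) ^ (1 / 2 : ℝ) * eLpNorm g 2 volume := h1.trans (by gcongr)
  have h3 := ENNReal.toReal_mono hfin h2
  rw [toReal_enorm, Real.norm_eq_abs, ENNReal.toReal_mul] at h3
  refine h3.trans_eq ?_
  congr 1
  rw [← ENNReal.toReal_rpow, ENNReal.coe_toReal, Real.sqrt_eq_rpow]

/-- The product of an `L²` slice with a smooth function is integrable. [folklore] -/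
theorem integrable_mul_of_memLp_of_isSmooth {f φ : UnitAddTorus d → ℝ} (hf : MemLp f 2 volume)
    (hφ : IsSmooth φ) : Integrable (fun y => f y * φ y) volume := by
  obtain ⟨x, -, hx⟩ := isCompact_univ.exists_isMaxOn univ_nonempty hφ.continuous.norm.continuousOn
  exact (hf.integrable one_le_two).mul_bdd hφ.continuous.aestronglyMeasurable
    (ae_of_all _ fun y => hx (mem_univ y))

/-- The primitive `t ↦ c + ∫_{(0,t]} F` of an integrable `F` is continuous on `[0, T]`. [folklore] -/
theorem continuousOn_const_add_setIntegral {T : ℝ} (hT : 0 ≤ T) {F : ℝ → ℝ}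
    (hF : IntegrableOn F (Ioo 0 T)) (c : ℝ) :
    ContinuousOn (fun t => c + ∫ τ in Ioc 0 t, F τ) (Icc 0 T) := by
  have hint : IntegrableOn F (Icc 0 T) := (integrableOn_Icc_iff_integrableOn_Ioo).2 hF
  rw [← uIcc_of_le hT] at hint
  have h1 := intervalIntegral.continuousOn_primitive_interval (μ := volume) hint
  rw [uIcc_of_le hT] at h1
  have h2 : ContinuousOn (fun t => c + ∫ τ in (0 : ℝ)..t, F τ) (Icc 0 T) := continuousOn_const.add h1
  refine h2.congr fun t ht => ?_
  show c + ∫ τ in Ioc 0 t, F τ = c + ∫ τ in (0 : ℝ)..t, F τ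
  rw [intervalIntegral.integral_of_le ht.1]

/-- **The steady-test identity at almost every time, for every test at once**: for a weak
sourced scalar, for a.e. `σ ∈ (0, T)` the slice `θ σ` is in `L²` and
`∫ θ(σ) φ = ∫ θ₀ φ + ∫_{(0,σ]} (∫ θ (u·∇φ + κΔφ) + ∫ s φ)` holds for EVERY smooth `φ` (not only
a.e. in `σ` for each `φ`): the identity holds a.e. for each member of a countable `L²`-dense
family of smooth functions (second countability of `L²(T^d)` and mollification), and both sides
are `L²`-continuous in `φ` at a good time — the right-hand side because it is, at every time, a
limit of values `∫ θ(t) φ` along the full-measure set of good times of `φ`. [folklore] -/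
theorem ae_forall_sliceIdentity (h : IsWeakScalarTransportForcedOn T κ u s θ₀ θ) :
    ∀ᵐ σ ∂(volume.restrict (Ioo 0 T)), MemLp (θ σ) 2 volume ∧ ∀ φ : UnitAddTorus d → ℝ, IsSmooth φ →
      ∫ y, θ σ y * φ y = (∫ y, θ₀ y * φ y) +
        ∫ τ in Ioc 0 σ, ((∫ y, θ τ y * (⟪u τ y, Torus.gradient φ y⟫_ℝ + κ * Torus.laplacian φ y)) +
          ∫ y, s τ y * φ y) := by
  rcases le_or_gt T 0 with hT0 | hT0
  · rw [Ioo_eq_empty_of_le hT0, Measure.restrict_empty, ae_zero]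
    exact Filter.eventually_bot
  obtain ⟨C, hC⟩ := h.ae_lintegral_sq_le
  have hmeas : ∀ᵐ t ∂(volume.restrict (Ioo 0 T)), AEStronglyMeasurable (θ t) volume :=
    h.aestronglyMeasurable_uncurry.prodMk_left
  -- ### notation: the flux-plus-source functional `F` and the right-hand side `mt`
  obtain ⟨F, hFeq⟩ : ∃ F : (UnitAddTorus d → ℝ) → ℝ → ℝ, ∀ φ τ, F φ τ =
      (∫ y, θ τ y * (⟪u τ y, Torus.gradient φ y⟫_ℝ + κ * Torus.laplacian φ y)) + ∫ y, s τ y * φ y :=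
    ⟨_, fun _ _ => rfl⟩
  obtain ⟨mt, hmteq⟩ : ∃ mt : (UnitAddTorus d → ℝ) → ℝ → ℝ, ∀ φ t, mt φ t =
      (∫ y, θ₀ y * φ y) + ∫ τ in Ioc 0 t, F φ τ := ⟨_, fun _ _ => rfl⟩
  -- the identity, one smooth test at a time (DiPerna–Lions (13)–(14), tree)
  have hslice : ∀ {φ : UnitAddTorus d → ℝ}, IsSmooth φ →
      ∀ᵐ t ∂(volume.restrict (Ioo 0 T)), ∫ y, θ t y * φ y = mt φ t := by
    intro φ hφ
    filter_upwards [h.ae_integral_mul_eq hφ] with t ht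
    rw [hmteq, ht]
    simp only [hFeq]
  -- ### the right-hand side is continuous in `t` on `[0, T]`
  have hcont : ∀ {φ : UnitAddTorus d → ℝ}, IsSmooth φ → ContinuousOn (mt φ) (Icc 0 T) := by
    intro φ hφ
    rw [show mt φ = _ from funext (hmteq φ), show F φ = _ from funext (hFeq φ)]
    exact continuousOn_const_add_setIntegral hT0.le
      (((h.integrable_mul_steadyFlux hφ).integral_prod_left).add
        ((h.integrable_source_mul_continuous hφ.continuous).integral_prod_left)) _
  -- ### a countable `L²`-dense family `Φ i n` of smooth functions
  haveI : Fact ((1 : ℝ≥0∞) ≤ 2) := ⟨by norm_num⟩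
  haveI : Fact ((2 : ℝ≥0∞) ≠ ⊤) := ⟨ENNReal.ofNat_ne_top⟩
  obtain ⟨q, hq⟩ := TopologicalSpace.exists_dense_seq (Lp ℝ 2 (volume : Measure (UnitAddTorus d)))
  have hΦex : ∀ i : ℕ, ∃ g : ℕ → UnitAddTorus d → ℝ, (∀ n, IsSmooth (g n)) ∧
      Tendsto (fun n => eLpNorm (g n - ⇑(q i)) 2 volume) atTop (𝓝 0) := fun i => by
    obtain ⟨g, hg, -, hlim⟩ := exists_isSmooth_tendsto_eLpNorm_sub (Lp.memLp (q i))
    exact ⟨g, hg, hlim⟩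
  choose Φ hΦs hΦlim using hΦex
  have hdense : ∀ {φ : UnitAddTorus d → ℝ}, MemLp φ 2 volume → ∀ ε : ℝ, 0 < ε →
      ∃ i n, (eLpNorm (φ - Φ i n) 2 volume).toReal < ε := by
    intro φ hφ ε hε
    have hε2 : 0 < ε / 2 := half_pos hε
    obtain ⟨i, hi⟩ := Metric.denseRange_iff.1 hq (hφ.toLp φ) (ε / 2) hε2
    obtain ⟨n, hn⟩ := ((hΦlim i).eventually (Iio_mem_nhds (ENNReal.ofReal_pos.2 hε2))).exists
    refine ⟨i, n, ENNReal.toReal_lt_of_lt_ofReal ?_⟩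
    have hA : eLpNorm (φ - ⇑(q i)) 2 volume < ENNReal.ofReal (ε / 2) := by
      rw [Lp.dist_def] at hi
      have hne : eLpNorm (⇑(hφ.toLp φ) - ⇑(q i)) 2 volume ≠ ⊤ :=
        ((Lp.memLp (hφ.toLp φ)).sub (Lp.memLp (q i))).eLpNorm_ne_top
      have hlt := (ENNReal.lt_ofReal_iff_toReal_lt hne).2 hi
      have hae : (⇑(hφ.toLp φ) - ⇑(q i) : UnitAddTorus d → ℝ) =ᵐ[volume] (φ - ⇑(q i)) :=
        (hφ.coeFn_toLp).sub EventuallyEq.rfl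
      rwa [eLpNorm_congr_ae hae] at hlt
    have hB : eLpNorm (⇑(q i) - Φ i n) 2 volume < ENNReal.ofReal (ε / 2) := by
      rw [eLpNorm_sub_comm]; exact hn
    calc eLpNorm (φ - Φ i n) 2 volume = eLpNorm ((φ - ⇑(q i)) + (⇑(q i) - Φ i n)) 2 volume := by
          rw [sub_add_sub_cancel]
      _ ≤ eLpNorm (φ - ⇑(q i)) 2 volume + eLpNorm (⇑(q i) - Φ i n) 2 volume :=
          eLpNorm_add_le (hφ.1.sub (Lp.memLp (q i)).1)
            ((Lp.memLp (q i)).1.sub ((hΦs i n).continuous.aestronglyMeasurable)) one_le_two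
      _ < ENNReal.ofReal (ε / 2) + ENNReal.ofReal (ε / 2) := ENNReal.add_lt_add hA hB
      _ = ENNReal.ofReal ε := by rw [← ENNReal.ofReal_add hε2.le hε2.le, add_halves]
  -- ### the good set of times
  have hgood : ∀ᵐ σ ∂(volume.restrict (Ioo 0 T)), ∀ i n, ∫ y, θ σ y * Φ i n y = mt (Φ i n) σ := by
    rw [ae_all_iff]; intro i; rw [ae_all_iff]; intro n; exact hslice (hΦs i n)
  filter_upwards [hC, hmeas, hgood, ae_restrict_mem measurableSet_Ioo] with σ hCσ hmσ hgσ hσ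
  have hL2 : MemLp (θ σ) 2 volume := memLp_two_of_lintegral_enorm_sq_le hmσ hCσ
  refine ⟨hL2, fun φ hφ => ?_⟩
  rw [show ((∫ y, θ₀ y * φ y) + ∫ τ in Ioc 0 σ, ((∫ y, θ τ y * (⟪u τ y, Torus.gradient φ y⟫_ℝ +
      κ * Torus.laplacian φ y)) + ∫ y, s τ y * φ y)) = mt φ σ by rw [hmteq]; simp only [hFeq]]
  -- ### the three-term estimate through `Φ i n`
  have key : ∀ i n, |(∫ y, θ σ y * φ y) - mt φ σ| ≤
      2 * (Real.sqrt C * (eLpNorm (φ - Φ i n) 2 volume).toReal) := by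
    intro i n
    -- (a) Hölder at `σ`
    have ha : |(∫ y, θ σ y * φ y) - ∫ y, θ σ y * Φ i n y| ≤
        Real.sqrt C * (eLpNorm (φ - Φ i n) 2 volume).toReal := by
      rw [← integral_sub (integrable_mul_of_memLp_of_isSmooth hL2 hφ)
        (integrable_mul_of_memLp_of_isSmooth hL2 (hΦs i n))]
      have := abs_integral_mul_le_sqrt_mul_eLpNorm hmσ ((hφ.memLp 2).sub ((hΦs i n).memLp 2)) hCσ
      simpa only [Pi.sub_apply, mul_sub] using this
    -- (b) the identity at `σ` for `Φ i n`
    have hb : ∫ y, θ σ y * Φ i n y = mt (Φ i n) σ := hgσ i n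
    -- (c) `|mt (Φ i n) σ - mt φ σ| ≤ √C ‖φ - Φ i n‖₂`: limit along the times good for both
    have hc : |mt (Φ i n) σ - mt φ σ| ≤ Real.sqrt C * (eLpNorm (φ - Φ i n) 2 volume).toReal := by
      set G : Set ℝ := {t | t ∈ Ioo 0 T ∧ ((∫ y, θ t y * φ y = mt φ t) ∧
        (∫ y, θ t y * Φ i n y = mt (Φ i n) t) ∧ (∫⁻ y, ‖θ t y‖ₑ ^ 2 ≤ C) ∧
        AEStronglyMeasurable (θ t) volume)} with hG
      have hσG : σ ∈ closure G := by
        apply mem_closure_of_ae_Ioo _ hσ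
        filter_upwards [hslice hφ, hslice (hΦs i n), hC, hmeas] with t h1 h2 h3 h4
        exact ⟨h1, h2, h3, h4⟩
      have hGsub : G ⊆ Icc 0 T := fun t ht => Ioo_subset_Icc_self ht.1
      have hbound : ∀ t ∈ G, |mt (Φ i n) t - mt φ t| ≤
          Real.sqrt C * (eLpNorm (φ - Φ i n) 2 volume).toReal := by
        rintro t ⟨-, h1, h2, h3, h4⟩
        have hL2t : MemLp (θ t) 2 volume := memLp_two_of_lintegral_enorm_sq_le h4 h3
        rw [← h1, ← h2, abs_sub_comm, ← integral_sub (integrable_mul_of_memLp_of_isSmooth hL2t hφ)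
          (integrable_mul_of_memLp_of_isSmooth hL2t (hΦs i n))]
        have := abs_integral_mul_le_sqrt_mul_eLpNorm h4 ((hφ.memLp 2).sub ((hΦs i n).memLp 2)) h3
        simpa only [Pi.sub_apply, mul_sub] using this
      have hcts : ContinuousWithinAt (fun t => |mt (Φ i n) t - mt φ t|) G σ :=
        ((((hcont (hΦs i n)).sub (hcont hφ)).abs).continuousWithinAt
          (Ioo_subset_Icc_self hσ)).mono hGsub
      haveI : (𝓝[G] σ).NeBot := mem_closure_iff_nhdsWithin_neBot.1 hσG
      exact le_of_tendsto hcts (eventually_nhdsWithin_of_forall hbound)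
    calc |(∫ y, θ σ y * φ y) - mt φ σ|
        = |((∫ y, θ σ y * φ y) - ∫ y, θ σ y * Φ i n y) + (mt (Φ i n) σ - mt φ σ)| := by
          rw [hb]; congr 1; ring
      _ ≤ |(∫ y, θ σ y * φ y) - ∫ y, θ σ y * Φ i n y| + |mt (Φ i n) σ - mt φ σ| := abs_add_le _ _
      _ ≤ 2 * (Real.sqrt C * (eLpNorm (φ - Φ i n) 2 volume).toReal) := by linarith [ha, hc]
  -- ### conclusion: the defect is below every `ε > 0`
  have hfin : ∀ ε : ℝ, 0 < ε → |(∫ y, θ σ y * φ y) - mt φ σ| < ε := by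
    intro ε hε
    have hCpos : 0 < 2 * Real.sqrt C + 1 := by positivity
    obtain ⟨i, n, hin⟩ := hdense (hφ.memLp 2) (ε / (2 * Real.sqrt C + 1)) (div_pos hε hCpos)
    calc |(∫ y, θ σ y * φ y) - mt φ σ|
        ≤ 2 * (Real.sqrt C * (eLpNorm (φ - Φ i n) 2 volume).toReal) := key i n
      _ ≤ 2 * (Real.sqrt C * (ε / (2 * Real.sqrt C + 1))) :=
          mul_le_mul_of_nonneg_left (mul_le_mul_of_nonneg_left hin.le (Real.sqrt_nonneg _)) (by norm_num)
      _ = ε * (2 * Real.sqrt C / (2 * Real.sqrt C + 1)) := by ring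
      _ < ε := by
          have h1 : 2 * Real.sqrt C / (2 * Real.sqrt C + 1) < 1 := (div_lt_one hCpos).2 (by linarith)
          exact mul_lt_of_lt_one_right hε h1
  exact sub_eq_zero.1 (abs_nonpos_iff.1 (le_of_forall_pos_lt_add (by simpa using hfin)))

end Trace

end Summit.AnomalousDissipation.AnomalousDissipation.Theorems

end
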